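import Summits.BirchSwinnertonDyer.BirchSwinnertonDyer.Theorems.ByReductionTypeAtTwoFineSelmerConjAAtTwoAdditivePotGoodClassNumberOneCriterionFrac
import Summits.BirchSwinnertonDyer.BirchSwinnertonDyer.Theorems.ByReductionTypeAtTwoFineSelmerConjAAtTwoAdditivePotGoodCensusDoorStampsA
import HarnessLib

/-!
# Route `ByReductionTypeAtTwo` (rung K4), crux C1″ `FineSelmerConjAAtTwoAdditivePotGood` (item stmt-BirchSwinnertonDyer-22615):
# CLASS NUMBER ONE FOR THE CUBIC FIELD OF DISCRIMINANT `8372` (`X³ + (-1)X² + (-299)X + (2093)`, index `1`) BY A NORM CERTIFICATE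
# (KERNEL) — the `2`-torsion point field `ℚ(P)` of the census row `301392cf1`, whose census stamp thereby needs NO displayed datum any more ((A)₂ modulo Lim 2017 Thm. 3.5 ALONE)
# (a `--supports 22615` file; seat `bsd-2adic-k4-w1` GEN 6; consumer of `…ClassNumberOneCriterion` / `…ClassNumberOneCriterionFrac`)

HONEST FRAMING (cell `bsd-2adic`, D-0036/D-0054): §1 UNCONDITIONAL kernel arithmetic; §2 conditional on `hLim2` (Lim 2017 Thm. 3.5 at `2`) BY NAME
and NOTHING ELSE; closes nothing at the `∀`-level; nothing booked; BSD is not proved by any of this.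

THE CERTIFICATE (generated by the seat's exact-arithmetic tools — reduced model, integral basis, relation sieve with Dedekind–Kummer
bookkeeping, unit reduction — and CHECKED HERE by the kernel): `g = X³ + (-1)X² + (-299)X + (2093)`, `disc g = 8372 = 1² · (8372)`;
`M_K < 26`.
For every prime `ℓ < 26` and every root `a` of `g mod ℓ` the proof lists a generator `(x + yθ + zθ²)/m` of the ideals `I ∋ ℓ, θ − a` of norm `ℓ`
(10 witnesses, 0 of them outside `ℤ[θ]`). No Dedekind–Kummer theory is invoked in the proof: the criterion only uses `𝓞/I ≅ 𝔽_ℓ`.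

References: [Marcus1977] Ch. 2 Exercise 27, Ch. 5 Thm. 35–37; [Cohen1993] §4.8.2, §6.3; [Lim2017FineSelmer] Thm. 3.5, Lemma 3.2;
[Greenberg2001IwasawaPastPresent] Prop. 2.1 (Iwasawa 1956); [Fukuda1994] Thm. 1 (1).
-/

set_option autoImplicit false
-- sibling precedent (`…ClassNumberOneCriterionFrac.lean`): the directory name repeats the summit name
set_option linter.dupNamespace false

noncomputable section

open scoped Classical IntermediateField NumberField Real nonZeroDivisors

namespace Summit.BirchSwinnertonDyer.BirchSwinnertonDyer.Theorems.AddKatoTwo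

open WeierstrassCurve Field Polynomial IsDedekindDomain NumberField Matrix Literature.NumberTheory.EllipticCurves
  Literature.NumberTheory.GaloisRepresentations
  Literature.NumberTheory.IwasawaTheory
  Summit.BirchSwinnertonDyer.BirchSwinnertonDyer.Theorems.AlignedTransportAtTwoTorsionPointField
  Summit.BirchSwinnertonDyer.BirchSwinnertonDyer.Theses.ByReductionTypeAtTwo

/-! ## §1 The certificate: `h = 1` for the field of `X³ + (-1)X² + (-299)X + (2093)` -/

section Certificate

variable (K : Type) [Field K] [NumberField K]

/-- `X³ + (-1)X² + (-299)X + (2093)` is irreducible over `ℚ` (no root mod `11`). -/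
theorem irreducible_cubic_d8372p : Irreducible (Cubic.toPoly ⟨1, ((-1 : ℤ) : ℚ), ((-299 : ℤ) : ℚ), ((2093 : ℤ) : ℚ)⟩) :=
  haveI : Fact (Nat.Prime 11) := ⟨by norm_num⟩
  irreducible_cubic_of_no_root_zmod 11 (by decide)

/-- **`h = 1` for every cubic number field whose integers contain a root `θ` of `X³ + (-1)X² + (-299)X + (2093)`** (`|disc| = 8372`, index
`1`, `M_K < 26`): a norm certificate — for every prime `ℓ < 26` and every root `a` of the cubic mod `ℓ` a generator
`(x + yθ + zθ²)/m ∈ 𝓞 K` of every ideal `I ∋ ℓ, θ − a` of norm `ℓ` (listed in the proof; `m > 1` = element of `𝓞 K ∖ ℤ[θ]`, certified by its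
scaled cubic identity). KERNEL.
[cite: Marcus1977, Ch. 5 Thm. 37 and Cor. 2] [cite: Cohen1993, §6.3] -/
theorem classNumber_eq_one_of_root_d8372p (h3 : Module.finrank ℚ K = 3) (b : 𝓞 K)
    (hb : b ^ 3 + (-1 : ℤ) * b ^ 2 + (-299 : ℤ) * b + (2093 : ℤ) = 0) : NumberField.classNumber K = 1 := by
  have hirr := irreducible_cubic_d8372p
  have hd : |NumberField.discr K| ≤ (8372 : ℕ) :=
    (abs_discr_le_abs_cubic_discr K h3 b hirr hb).trans (by simp only [Cubic.discr]; norm_num)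
  refine classNumber_eq_one_of_prime_norm_principal K h3 (B := 26)
    (minkowskiBound_lt_of_sqrt_le K h3 hd (s := 91.50)
      ((Real.sqrt_le_sqrt (by norm_num : ((8372 : ℕ) : ℝ) ≤ (91.50 : ℝ) ^ 2)).trans (Real.sqrt_sq (by norm_num)).le)
      (by norm_num)) ?_
  intro ℓ hℓB hℓ J hJ
  interval_cases ℓ <;> norm_num at hℓ
  · -- `ℓ = 2`: roots [1]
    refine isPrincipal_of_absNorm_eq_prime K h3 b hirr hb (by norm_num) (fun a ha hdvd => ?_) hJ
    interval_cases a <;> norm_num at hdvd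
    · exact ⟨(-31), 3, 0, by norm_num, by norm_num⟩
  · -- `ℓ = 3`: roots [1]
    refine isPrincipal_of_absNorm_eq_prime K h3 b hirr hb (by norm_num) (fun a ha hdvd => ?_) hJ
    interval_cases a <;> norm_num at hdvd
    · exact ⟨10, (-1), 0, by norm_num, by norm_num⟩
  · -- `ℓ = 5`: roots [4]
    refine isPrincipal_of_absNorm_eq_prime K h3 b hirr hb (by norm_num) (fun a ha hdvd => ?_) hJ
    interval_cases a <;> norm_num at hdvd
    · exact ⟨(-41), 4, 0, by norm_num, by norm_num⟩
  · -- `ℓ = 7`: roots [0, 4]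
    refine isPrincipal_of_absNorm_eq_prime K h3 b hirr hb (by norm_num) (fun a ha hdvd => ?_) hJ
    interval_cases a <;> norm_num at hdvd
    · exact ⟨(-21), 2, 0, by norm_num, by norm_num⟩
    · exact ⟨608, (-28), (-3), by norm_num, by norm_num⟩
  · -- `ℓ = 11`: roots none
    refine isPrincipal_of_absNorm_eq_prime K h3 b hirr hb (by norm_num) (fun a ha hdvd => ?_) hJ
    interval_cases a <;> norm_num at hdvd
  · -- `ℓ = 13`: roots [0, 1]
    refine isPrincipal_of_absNorm_eq_prime K h3 b hirr hb (by norm_num) (fun a ha hdvd => ?_) hJ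
    interval_cases a <;> norm_num at hdvd
    · exact ⟨(-52), 5, 0, by norm_num, by norm_num⟩
    · exact ⟨(-72), 7, 0, by norm_num, by norm_num⟩
  · -- `ℓ = 17`: roots none
    refine isPrincipal_of_absNorm_eq_prime K h3 b hirr hb (by norm_num) (fun a ha hdvd => ?_) hJ
    interval_cases a <;> norm_num at hdvd
  · -- `ℓ = 19`: roots [17]
    refine isPrincipal_of_absNorm_eq_prime K h3 b hirr hb (by norm_num) (fun a ha hdvd => ?_) hJ
    interval_cases a <;> norm_num at hdvd
    · exact ⟨(-816), 37, 4, by norm_num, by norm_num⟩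
  · -- `ℓ = 23`: roots [0, 1]
    refine isPrincipal_of_absNorm_eq_prime K h3 b hirr hb (by norm_num) (fun a ha hdvd => ?_) hJ
    interval_cases a <;> norm_num at hdvd
    · exact ⟨(-6325), 287, 31, by norm_num, by norm_num⟩
    · exact ⟨(-412), 19, 2, by norm_num, by norm_num⟩

end Certificate

/-! ## §2 The census row `301392cf1` -/

/-- **(A)₂ for the census curve `301392cf1` modulo Lim 2017 Thm. 3.5 ALONE — NO displayed datum.** Its `2`-torsion cubic field
(`d = 8372`) has `h = 1` BY THE KERNEL (`classNumber_eq_one_of_root_d8372p`): the element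
`θ = 21950663899/148605093 + (356141/148605093)·β + (-31/297210186)·β²` of `ℚ(β)` (`β` a root of the `2`-division cubic) is a root of `X³ + (-1)X² + (-299)X + (2093)` and
`β = -17971 + (-1794)·θ + (93)·θ²`, so `ℚ(P) = ℚ(β) = ℚ(θ)` (identities = `linear_combination`s of the `2`-division relation; coefficients
found by exact linear algebra in `ℚ[X]/(G)`). UPGRADES `conjA_two_301392cf1_of_oddClassNumber`. [cite: Lim2017FineSelmer, §3 Thm. 3.5 and Lemma 3.2]
[cite: Greenberg2001IwasawaPastPresent, Prop. 2.1 p. 339] [cite: Cohen1993, §6.3] -/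
theorem conjA_two_301392cf1
    (hLim2 : Lim2017.thm35_at_two_fineSelmerDual_moduleFinite_of_classicalMuVanishes_of_le_divisionField_four)
    (κ : ZpExtension ℚ 2) (hκ : κ.IsCyclotomic) :
    haveI := isElliptic_301392cf1'
    ∃ (γ : absoluteGaloisGroup ℚ) (D : (⟨0, ((0 : ℤ) : ℚ), 0, ((-2119464084 : ℤ) : ℚ), ((-37556677760852 : ℤ) : ℚ)⟩ : WeierstrassCurve ℚ).FineSelmerDualData κ γ),
      Module.Finite ℤ_[2] (RestrictScalars ℤ_[2] (IwasawaAlgebra 2) D.X) := by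
  haveI := isElliptic_301392cf1'
  obtain ⟨β, hβ⟩ : ∃ β : AlgebraicClosure ℚ, aeval β (Cubic.toPoly ⟨1, ((0 : ℤ) : ℚ), ((-2119464084 : ℤ) : ℚ), ((-37556677760852 : ℤ) : ℚ)⟩) = 0 :=
    IsAlgClosed.exists_aeval_eq_zero _ _ (by rw [Cubic.degree_of_a_ne_zero one_ne_zero]; norm_num)
  have hβ' : β ^ 3 + (0 : AlgebraicClosure ℚ) * β ^ 2 + (-2119464084 : AlgebraicClosure ℚ) * β + (-37556677760852 : AlgebraicClosure ℚ) = 0 := by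
    have := hβ
    simp only [Cubic.toPoly, map_one, one_mul, aeval_add, aeval_mul, aeval_C, aeval_X_pow, aeval_X,
      eq_ratCast, Rat.cast_intCast] at this
    push_cast at this
    linear_combination this
  set θ : AlgebraicClosure ℚ := algebraMap ℚ (AlgebraicClosure ℚ) (21950663899 / 148605093 : ℚ) +
      algebraMap ℚ (AlgebraicClosure ℚ) (356141 / 148605093 : ℚ) * β + algebraMap ℚ (AlgebraicClosure ℚ) (-31 / 297210186 : ℚ) * β ^ 2 with hθdef
  have hθ : aeval θ (Cubic.toPoly ⟨1, ((-1 : ℤ) : ℚ), ((-299 : ℤ) : ℚ), ((2093 : ℤ) : ℚ)⟩) = 0 := by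
    simp only [Cubic.toPoly, map_one, one_mul, aeval_add, aeval_mul, aeval_C, aeval_X_pow, aeval_X, eq_ratCast,
      Rat.cast_intCast]
    rw [hθdef]
    simp only [eq_ratCast]
    push_cast
    linear_combination (((-552064335698258083 : AlgebraicClosure ℚ) / 6563433315660843659478714) + ((13423 : AlgebraicClosure ℚ) / 22083473665538649) * β + ((342251501 : AlgebraicClosure ℚ) / 4375622210440562439652476) * β ^ 2 + ((-29791 : AlgebraicClosure ℚ) / 26253733262643374637914856) * β ^ 3) * hβ'
  have hadj : IntermediateField.adjoin ℚ {θ} = IntermediateField.adjoin ℚ {β} := by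
    apply le_antisymm
    · rw [IntermediateField.adjoin_simple_le_iff, hθdef]
      have hβmem := IntermediateField.mem_adjoin_simple_self ℚ β
      exact add_mem (add_mem (algebraMap_mem _ _) (mul_mem (algebraMap_mem _ _) hβmem))
        (mul_mem (algebraMap_mem _ _) (pow_mem hβmem 2))
    · rw [IntermediateField.adjoin_simple_le_iff]
      have hβeq : β = algebraMap ℚ (AlgebraicClosure ℚ) (-17971 : ℚ) + algebraMap ℚ (AlgebraicClosure ℚ) (-1794 : ℚ) * θ +
          algebraMap ℚ (AlgebraicClosure ℚ) (93 : ℚ) * θ ^ 2 := by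
        rw [hθdef]; simp only [eq_ratCast]; push_cast; linear_combination (((342251501 : AlgebraicClosure ℚ) / 7361157888512883) + ((-29791 : AlgebraicClosure ℚ) / 29444631554051532) * β) * hβ'
      rw [hβeq]
      have hθmem := IntermediateField.mem_adjoin_simple_self ℚ θ
      exact add_mem (add_mem (algebraMap_mem _ _) (mul_mem (algebraMap_mem _ _) hθmem))
        (mul_mem (algebraMap_mem _ _) (pow_mem hθmem 2))
  refine conjA_two_301392cf1_of_oddClassNumber hLim2 hβ ?_ κ hκ
  rw [← hadj]
  exact not_two_dvd_card_classGroup_adjoin_of_forall_cubicField irreducible_cubic_d8372p (classNumber_eq_one_of_root_d8372p) hθ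

end Summit.BirchSwinnertonDyer.BirchSwinnertonDyer.Theorems.AddKatoTwo

end
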